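import Mathlib

/-!
# `NoHeavyLowerTail` (crux stmt-CriticalPhenomena-4575), Sahi programme (lineage prim-master-conj, gen 40): the FINITE KERNEL
# behind "Sahi's `E₃ ≥ 0` on every product of THREE finite chains, every product measure" — definitions, the checker, and
# its elementary soundness plumbing (no analysis, no `native_decide` here)

Support file (`--supports stmt-CriticalPhenomena-4575`).  Nothing here is specific to percolation; nothing is asserted about the crux.

## The mathematics (memo `prim-l12/FROM-prim-master-conj-g40-FULL-POLARISATION.md`, POINTWISE §41; to be formalised in `…SahiThreeChainsBridge*`)

For up-sets `a, b, c` of `P = [m₁]×[m₂]×[m₃]` with a product probability weight `w`, Sahi's third functional expands over three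
independent copies as `E₃(1_a,1_b,1_c) = Σ_{(x,y,z) ∈ P³} w(x)w(y)w(z)·G(x,y,z)`,
`G = 2[x∈abc] − [x∈a][y∈bc] − [x∈b][y∈ac] − [x∈c][y∈ab] + [x∈a][y∈b][z∈c]`.  The weight of `(x,y,z)` is invariant under permuting,
on each axis separately, the three coordinates among the three points (group `S₃³`), so `E₃ = Σ_orbits w(orbit)·Σ_orbit G`, and the
orbit sum only sees the traces of `a,b,c` on the sub-grid of the (at most three) levels involved on each axis: pulling back along the
sorted level maps `[3] → {levels}` it becomes `κ₃(ã,b̃,c̃) := Σ_{Latin (x,y,z) ⊆ [3]³} G` for up-sets `ã,b̃,c̃ ⊆ [3]³` ('Latin' = on every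
axis the three points carry the levels `0,1,2` in some order; `6³ = 216` ordered triples), up to a positive factor.  HENCE:
`κ₃ ≥ 0` for all up-set triples of `[3]³` ⟹ `E₃ ≥ 0` on every product of three chains with every product measure (and then on `[0,1]³`,
Lieb–Sahi 2022 Lemma 2.3) — the three-dimensional case of Sahi's conjecture [Sahi 2008 Conj. 5; Lieb–Sahi 2022: proved on `[0,1]²`;
Gladkov arXiv:2408.08457 Rem. 8.8: "(25) is still a conjecture"].  `κ₃` is trilinear; as a function of `a` it is
`Σ_{u ∈ a} φ_{b,c}(u)` with the integer charge `φ` below, so the finite fact is: **for all up-sets `b, c ⊆ [3]³`, the minimum over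
up-sets `a` of `Σ_{u∈a} φ_{b,c}(u)` is `≥ 0`** — `980² = 960 400` exact dynamic programmes over nested slices.  Checked outside Lean by
four independent programs (HOME/code-g40, kit j246852: all `157 345 860` unordered triples, `0` negative, `484 587` zeros); the
in-kernel evaluation (`native_decide`, four blocks of `245 × 980` pairs, ≈ 2 min each) is `…SahiThreeChainsCheckA…D`.

## Encodings (all data are natural-number bitmasks; everything is computable and structurally recursive)

cell `(i,j,k) ∈ [3]³ ↦ u = i + 3j + 9k < 27`; a subset of `[3]³` ↦ `T < 2^27` (bit `u`); a subset of `[3]²` ↦ `S < 2^9` (bit `i + 3j`);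
slice `k` of `T` occupies bits `9k … 9k+8`; an UP-set of `[3]³` has increasing slices `S₀ ⊆ S₁ ⊆ S₂`, each an up-set of `[3]²`.

## Contents

`coords`, `latinNbrs`/`latinTab` (the 8 Latin partners `(y,z)` of a cell), `b2i`, `phi` (the charge `φ_{B,C}(u)`), `phiTab`; `isUp2`, `ups2`
(the 20 up-sets of `[3]²`, a `filter` of `range 512` — trivially complete), `bits2`, `subIdx`, `ups3` (the 980 up-sets of `[3]³` assembled
from nested slices), `sliceCost`, `minOver` (+ `minOver_le`, `minOver_le_head`), `minUp3` (exact DP minimum of `Σ_{u∈A} f u` over up-sets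
`A`), `checkBlock lo hi` (the test on `B`-indices `[lo,hi)` × all `C`), `checkBlock_sound` (unpacking `List.all`).  The identification of `κ₃` with `Σ φ`, the completeness of `ups3`, the bound `minUp3 f ≤ Σ_{u∈A} f u`, the orbit/pull-back
lemmas and the final `SahiPositive` theorem are the bridge files' job (blueprint: memo §5).
-/

namespace Summit.CriticalPhenomena.PercolationContinuityZ3.Theorems.SahiThreeChains

/-! ## Cells of `[3]³` and Latin partners -/

/-- Coordinates of a cell code `u < 27`: `(u % 3, (u / 3) % 3, u / 9)`. [this work] -/
def coords (u : ℕ) : ℕ × ℕ × ℕ := (u % 3, (u / 3) % 3, u / 9)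

/-- The 8 Latin partners `(y, z)` of the cell `u`: `y` differs from `u` in every coordinate and `z` is the completing cell
(`z_t = 3 − u_t − y_t`), so that `(u, y, z)` carries the levels `0,1,2` in some order on every axis. [this work] -/
def latinNbrs (u : ℕ) : List (ℕ × ℕ) :=
  let (i, j, k) := coords u
  (List.range 27).filterMap fun y =>
    let (i', j', k') := coords y
    if i' ≠ i ∧ j' ≠ j ∧ k' ≠ k then some (y, (3 - i - i') + 3 * (3 - j - j') + 9 * (3 - k - k')) else none

/-- Table of Latin partners for all 27 cells (computed once). [this work] -/
def latinTab : Array (List (ℕ × ℕ)) := ((List.range 27).map latinNbrs).toArray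

/-- Boolean to integer. [this work] -/
def b2i (b : Bool) : ℤ := if b then 1 else 0

/-- The charge `φ_{B,C}(u) = 16[u∈B∩C] − Σ_{(y,z) Latin partners of u} ([y∈B][y∈C] + [u∈C][y∈B] + [u∈B][y∈C] − [y∈B][z∈C])`:
the coefficient of `[u ∈ A]` in `κ₃(A,B,C)`. [this work] -/
def phi (B C u : ℕ) : ℤ :=
  let uB := B.testBit u
  let uC := C.testBit u
  16 * b2i (uB && uC) -
    ((latinTab.getD u []).map fun p =>
      b2i (B.testBit p.1 && C.testBit p.1) + b2i (uC && B.testBit p.1) + b2i (uB && C.testBit p.1) -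
        b2i (B.testBit p.1 && C.testBit p.2)).sum

/-- The table `u ↦ φ_{B,C}(u)`, `u < 27`. [this work] -/
def phiTab (B C : ℕ) : Array ℤ := ((List.range 27).map (phi B C)).toArray

/-! ## Up-sets of `[3]²` and `[3]³` -/

/-- Up-set test for a bitmask of `[3]²` (cell `(i,j) ↦ i + 3j`): closed under increasing either coordinate. [this work] -/
def isUp2 (S : ℕ) : Bool :=
  (List.range 9).all fun v =>
    !S.testBit v || ((v % 3 == 2 || S.testBit (v + 1)) && (v / 3 == 2 || S.testBit (v + 3)))

/-- The up-sets of `[3]²` as bitmasks (`20` of them; a filter of `range 512`, hence trivially complete). [this work] -/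
def ups2 : Array ℕ := ((List.range 512).filter isUp2).toArray

/-- The set bits (cells) of each member of `ups2`. [this work] -/
def bits2 : Array (List ℕ) := ups2.map fun S => (List.range 9).filter fun v => S.testBit v

/-- For each index `a < 20`, the indices `a'` with `ups2[a'] ⊆ ups2[a]`. [this work] -/
def subIdx : Array (List ℕ) :=
  ups2.map fun S => (List.range ups2.size).filter fun a' => (ups2.getD a' 0 &&& S) == ups2.getD a' 0

/-- The up-sets of `[3]³` as bitmasks, assembled from nested slices `S₀ ⊆ S₁ ⊆ S₂` of up-sets of `[3]²` (slice `k` in bits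
`9k…9k+8`); `980` of them. [this work] -/
def ups3 : Array ℕ :=
  ((List.range ups2.size).flatMap fun a2 => (subIdx.getD a2 []).flatMap fun a1 => (subIdx.getD a1 []).map fun a0 =>
    ups2.getD a0 0 ||| (ups2.getD a1 0 <<< 9) ||| (ups2.getD a2 0 <<< 18)).toArray

/-! ## The exact minimum over up-sets (dynamic programming over nested slices) -/

/-- Cost of `ups2[a]` placed as slice `k` for the table `f`: `Σ_{v ∈ ups2[a]} f (v + 9k)`. [this work] -/
def sliceCost (f : Array ℤ) (k a : ℕ) : ℤ := ((bits2.getD a []).map fun v => f.getD (v + 9 * k) 0).sum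

/-- Minimum of `g` over a list of indices (started at the head; junk value `0` on `[]`, never used). [this work] -/
def minOver (g : ℕ → ℤ) : List ℕ → ℤ
  | [] => 0
  | a :: as => as.foldl (fun m a' => min m (g a')) (g a)

/-- The running minimum of a `foldl min` is below its start. [this work] -/
theorem foldl_min_le_init (g : ℕ → ℤ) (l : List ℕ) (m : ℤ) : l.foldl (fun m a' => min m (g a')) m ≤ m := by
  induction l generalizing m with
  | nil => simp
  | cons a l ih => exact le_trans (ih _) (min_le_left _ _)

/-- The running minimum of a `foldl min` is below every listed value. [this work] -/
theorem foldl_min_le_mem (g : ℕ → ℤ) (l : List ℕ) (m : ℤ) {a : ℕ} (ha : a ∈ l) :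
    l.foldl (fun m a' => min m (g a')) m ≤ g a := by
  induction l generalizing m with
  | nil => simp at ha
  | cons b l ih =>
    rcases List.mem_cons.1 ha with rfl | h
    · exact le_trans (foldl_min_le_init g l _) (min_le_right _ _)
    · exact ih _ h

/-- `minOver g l ≤ g a` for every `a ∈ l`. [this work] -/
theorem minOver_le (g : ℕ → ℤ) {l : List ℕ} {a : ℕ} (ha : a ∈ l) : minOver g l ≤ g a := by
  cases l with
  | nil => simp at ha
  | cons b l =>
    rcases List.mem_cons.1 ha with rfl | h
    · exact foldl_min_le_init g l _
    · exact foldl_min_le_mem g l _ h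

/-- **`minUp3 f`**: the exact minimum of `Σ_{u ∈ A} f u` over all up-sets `A` of `[3]³`, computed as
`min_{S₂} [c₂(S₂) + min_{S₁ ⊆ S₂} [c₁(S₁) + min_{S₀ ⊆ S₁} c₀(S₀)]]` over `ups2`. [this work] -/
def minUp3 (f : Array ℤ) : ℤ :=
  let c0 : Array ℤ := ((List.range 20).map fun a => sliceCost f 0 a).toArray
  let c1 : Array ℤ := ((List.range 20).map fun a => sliceCost f 1 a).toArray
  let c2 : Array ℤ := ((List.range 20).map fun a => sliceCost f 2 a).toArray
  let g0 : Array ℤ := ((List.range 20).map fun a1 => minOver (fun a0 => c0.getD a0 0) (subIdx.getD a1 [])).toArray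
  let g1 : Array ℤ := ((List.range 20).map fun a2 =>
    minOver (fun a1 => c1.getD a1 0 + g0.getD a1 0) (subIdx.getD a2 [])).toArray
  minOver (fun a2 => c2.getD a2 0 + g1.getD a2 0) (List.range 20)

/-! ## The checker -/

/-- **The three-chains check on the block of `B`-indices `[lo, hi)`**: for every `b ∈ [lo,hi)` and every `c < 980`,
`minUp3 (φ-table of (ups3[b], ups3[c])) ≥ 0`. [this work] -/
def checkBlock (lo hi : ℕ) : Bool :=
  ((List.range (hi - lo)).map (· + lo)).all fun b => (List.range 980).all fun c =>
    decide (0 ≤ minUp3 (phiTab (ups3.getD b 0) (ups3.getD c 0)))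

/-- Unpacking a passed block: every pair `(b, c)` with `lo ≤ b < hi`, `c < 980` has a nonnegative DP minimum. [this work] -/
theorem checkBlock_sound {lo hi : ℕ} (h : checkBlock lo hi = true) {b c : ℕ} (hlo : lo ≤ b) (hhi : b < hi) (hc : c < 980) :
    0 ≤ minUp3 (phiTab (ups3.getD b 0) (ups3.getD c 0)) := by
  simp only [checkBlock, List.all_eq_true, List.mem_map, List.mem_range, decide_eq_true_eq,
    forall_exists_index, and_imp] at h
  have := h b (b - lo) (by omega) (by omega) c hc
  exact this

end Summit.CriticalPhenomena.PercolationContinuityZ3.Theorems.SahiThreeChains
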